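/-
Copyright: literature formalisation for the harness. Statements follow the cited text.
-/
import Literature.AlgebraicGeometry.CossartPiltant200819.LatticeMoves2008
import Literature.AlgebraicGeometry.CossartPiltant200819.LatticeEuclid2008
import Mathlib.Data.Fintype.Lattice
import HarnessLib

/-!
# Cossart–Piltant I (2008), Lemma 9.4 — the lattice step holds for every `d ≥ 3`

V. Cossart, O. Piltant, *Resolution of singularities of threefolds in positive characteristic I*,
J. Algebra 320 (2008) 1051–1082 [CossartPiltant2008]; manuscript hal-00139124 ("HAL"), proof
of Lemma 9.4 (journal Lemma 9.2), p. 30, l. 23–31: the basis `(v₁, v₂, v₃)` with properties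
(a)(b)(c), i.e. `CP2008.LatticeABC 3 l t w` (`TameDescent2008`). Third of three files
(`LatticeMoves2008`, `LatticeEuclid2008`, this file). MAIN RESULT:

* `latticeABC_of_three_le : 3 ≤ d → LatticeABC d l t w` for every prime `l`, every nonzero
  character vector `t : Fin d → ℤ/l` and every weight vector `w` with all `wⱼ > 0` (the values
  `W(xⱼ)` of a rank-one valuation on regular parameters are positive reals).

Together with `not_latticeABC_two_five` (`d = 2`: FALSE) this makes the dimension-dependence of
the printed "by elementary linear algebra" a kernel-checked dichotomy: the assertion fails in
two variables and holds from three variables on; the proof below USES a third variable (as a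
reservoir coin), and `not_latticeABC_two_five` shows that some use of `d ≥ 3` is unavoidable.
(No compatibility hypothesis between `t` and `w` is needed; for commensurable weights the
statement holds in every dimension, `latticeABC_of_commensurable`.)

PROOF (reading notes to HAL p. 30, l. 23–31; all of it kernel-checked below). If no two weights
have irrational ratio the weights are commensurable (`LatticeMoves2008`). Otherwise relabel so
that `w₀/w₁ ∉ ℚ` and run the Euclidean algorithm on the coins of rows `0, 1` (`erem`, `equot`,
`echar`: remainders, quotients, charges; `stage`: the state after `m` steps is admissible, by the
legal moves of `LatticeMoves2008`). The remainders decrease to `0` (`erem_small`), so at all late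
stages the two running coins are below `wⱼ/(l−1)` for every `j` and below `w₂/B(l)` for the
budget constant `B(l) = ((l−1)²+1)(l−1)^{2l+2}`. DICHOTOMY: either some late stage has a zero
charge among the two running rows or a quotient `≥ l − 1` — then one of the finishing criteria
applies at once (`main012`, four cases) —, or from some late stage `N` on both running charges
are nonzero and all quotients are `≤ l − 2` ("bounded tail"). In the latter case (`reservoir`)
let `x > x'` be the running coins at stage `N`, `θ = x/x'`, and let `m` be least with
`r_{N+2+m} ≤ x'/(l−1)`; writing `r_{N+2+m} = A x + B x'` with the local Euclid coefficients
(`lA`, `lB`, `erem_eq_lin` of `LatticeEuclid2008`) one has `A ≠ 0` (`lA_ne_zero`),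
`|A| ≤ (l−1)^{m+2} ≤ (l−1)^{2l+2}` (`abs_lA_le`, bounded tail) and `|A| θ ≡ ±δ (mod ℤ)` with
`δ = r_{N+2+m}/x' ∈ ((l−1)⁻², (l−1)⁻¹]`
(minimality of `m` and the bounded tail). Stepping the reservoir coin `X = w₂` down by `|A|·x`
at a time moves `X/x' (mod 1)` by `∓δ` at a time, so after `j ≤ δ⁻¹ + 1 < (l−1)² + 1` such steps
and one reduction modulo `x'` the reservoir coin becomes `y ∈ (0, x'/(l−1)]`
(`exists_fract_mem`, an elementary covering statement — no continued-fraction theory and no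
Dirichlet principle is used); the budget `j |A| x ≤ B(l) x ≤ X` makes these moves legal. If the
new charge of row `2` is nonzero, row `2` is dominant; if it is zero, row `2` is a small neutral
coin next to the charged row `1` (`Adm.abc_of_neutral`). ∎

Cell record: pub-hironaka GAPS §GA G7-A21.L / F2-(ii) (there a paper proof via continued
fractions under a compatibility hypothesis; the present proof is different and hypothesis-free).
No statement of [CossartPiltant2008] is contradicted by anything in this file: it SUPPORTS the
printed Lemma 9.4 at this step, in the dimension where the paper uses it.

## Sources

* V. Cossart, O. Piltant, J. Algebra 320 (2008), Lemma 9.2 = HAL hal-00139124 Lemma 9.4, proof,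
  p. 30, l. 23–31. [CossartPiltant2008]
-/

noncomputable section

namespace Literature.AlgebraicGeometry.CossartPiltant200819.CP2008

open Matrix

namespace Lattice94

/-! ### The game in `n + 3` variables with `w₀/w₁` irrational -/

section Main

variable {l n : ℕ}

/-- `0 ≠ 1` in `Fin (n+3)`. [folklore] -/
theorem fin_zero_ne_one : (0 : Fin (n + 3)) ≠ 1 := by
  simp

/-- `0 ≠ 2` in `Fin (n+3)`. [folklore] -/
theorem fin_zero_ne_two : (0 : Fin (n + 3)) ≠ 2 := by
  simp [Fin.ext_iff, Nat.mod_eq_of_lt (show 2 < n + 3 by omega)]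

/-- `1 ≠ 2` in `Fin (n+3)`. [folklore] -/
theorem fin_one_ne_two : (1 : Fin (n + 3)) ≠ 2 := by
  simp [Fin.ext_iff, Nat.mod_eq_of_lt (show 2 < n + 3 by omega),
    Nat.mod_eq_of_lt (show 1 < n + 3 by omega)]

/-- **The state after `m` Euclid steps on rows `0, 1` is admissible**: coins `(r_m, r_{m+1},
w₂, …)`, charges `(u_m, u_{m+1}, t₂, …)`. Each step is the legal move `v₀ ← v₀ − q_m v₁`
followed by the relabelling `0 ↔ 1`. [folklore] -/
theorem stage {t : Fin (n + 3) → ZMod l} {w : Fin (n + 3) → ℝ} (hx : Irrational (w 0 / w 1))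
    (hw : ∀ j, 0 < w j) (m : ℕ) :
    ∃ V C : Matrix (Fin (n + 3)) (Fin (n + 3)) ℤ, Adm w V C ∧
      rw V w 0 = erem (w 0) (w 1) m ∧ rw V w 1 = erem (w 0) (w 1) (m + 1) ∧
      (∀ j, j ≠ 0 → j ≠ 1 → rw V w j = w j) ∧
      rt V t 0 = echar (w 0) (w 1) (t 0) (t 1) m ∧
      rt V t 1 = echar (w 0) (w 1) (t 0) (t 1) (m + 1) ∧
      (∀ j, j ≠ 0 → j ≠ 1 → rt V t j = t j) := by
  induction m with
  | zero =>
    exact ⟨1, 1, Adm.one fun j => (hw j).le, by rw [rw_one, erem_zero],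
      by rw [rw_one, erem_one], fun j _ _ => rw_one w j, by rw [rt_one, echar_zero],
      by rw [rt_one, echar_one], fun j _ _ => rt_one t j⟩
  | succ m ih =>
    obtain ⟨V, C, hA, h0, h1, hj, c0, c1, cj⟩ := ih
    have h0p := hw 0
    have h1p := hw 1
    set q := equot (w 0) (w 1) m with hq
    have hle : (q : ℝ) * rw V w 1 ≤ rw V w 0 := by
      rw [h0, h1]
      exact equot_mul_le hx h0p h1p m
    have hA' := (hA.transvect fin_zero_ne_one q hle).perm (Equiv.swap 0 1)
    refine ⟨_, _, hA', ?_, ?_, ?_, ?_, ?_, ?_⟩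
    · rw [rw_submatrix, Equiv.swap_apply_left, rw_transvection_mul, if_neg fin_zero_ne_one.symm,
        add_zero, h1]
    · rw [rw_submatrix, Equiv.swap_apply_right, rw_transvection_mul, if_pos rfl, h0, h1,
        show m + 1 + 1 = m + 2 by ring, erem_add_two]
      push_cast
      ring
    · intro j hj0 hj1
      rw [rw_submatrix, Equiv.swap_apply_of_ne_of_ne hj0 hj1, rw_transvection_mul, if_neg hj0,
        add_zero, hj j hj0 hj1]
    · rw [rt_submatrix, Equiv.swap_apply_left, rt_transvection_mul, if_neg fin_zero_ne_one.symm,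
        add_zero, c1]
    · rw [rt_submatrix, Equiv.swap_apply_right, rt_transvection_mul, if_pos rfl, c0, c1,
        show m + 1 + 1 = m + 2 by ring, echar_add_two]
      push_cast
      ring
    · intro j hj0 hj1
      rw [rt_submatrix, Equiv.swap_apply_of_ne_of_ne hj0 hj1, rt_transvection_mul, if_neg hj0,
        add_zero, cj j hj0 hj1]

set_option maxHeartbeats 400000 in
/-- **The reservoir argument** (bounded tail from stage `N` on ⇒ win): see the module
docstring. [folklore] -/
theorem reservoir [Fact l.Prime] {t : Fin (n + 3) → ZMod l} {w : Fin (n + 3) → ℝ}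
    (hw : ∀ j, 0 < w j) (hx : Irrational (w 0 / w 1)) (N : ℕ) (hN : 1 ≤ N)
    (htail : ∀ m, N ≤ m → echar (w 0) (w 1) (t 0) (t 1) m ≠ 0 ∧
      echar (w 0) (w 1) (t 0) (t 1) (m + 1) ≠ 0 ∧
      erem (w 0) (w 1) m < ((l : ℝ) - 1) * erem (w 0) (w 1) (m + 1))
    (hlate : ∀ j, ((l : ℝ) - 1) * erem (w 0) (w 1) N ≤ w j)
    (hbud : (((l : ℝ) - 1) ^ 2 + 1) * ((l : ℝ) - 1) ^ (2 * l + 2) * erem (w 0) (w 1) N ≤ w 2) :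
    LatticeABC (n + 3) l t w := by
  classical
  have h0p := hw 0
  have h1p := hw 1
  -- notation
  set r : ℕ → ℝ := erem (w 0) (w 1) with hr
  have rpos : ∀ m, 0 < r m := erem_pos hx h0p h1p
  set x := r N with hxdef
  set x' := r (N + 1) with hx'def
  have hxx' : x' < x := by
    obtain ⟨N', rfl⟩ : ∃ N', N = N' + 1 := ⟨N - 1, by omega⟩
    exact erem_lt hx h0p h1p N'
  have hx'pos : 0 < x' := rpos (N + 1)
  have hxpos : 0 < x := rpos N
  set Λ : ℝ := (l : ℝ) - 1 with hΛ
  have hΛ1 : 1 ≤ Λ := one_le_cast_prime_sub_one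
  -- bounded tail ⇒ `Λ > 1` (i.e. `l ≥ 3`)
  have hΛgt : 1 < Λ := by
    have := (htail N le_rfl).2.2
    by_contra hle
    push Not at hle
    have : x < Λ * x' := this
    nlinarith
  have hΛpos : 0 < Λ := by linarith
  -- the quotient bound and the growth bound
  have hq : ∀ j, N ≤ j → (equot (w 0) (w 1) j : ℤ) ≤ ((l : ℤ) - 1) - 1 := by
    intro j hj
    have h := (htail j hj).2.2
    have hlt : equot (w 0) (w 1) j < l - 1 := by
      unfold equot
      rw [Nat.floor_lt (div_nonneg (rpos j).le (rpos (j + 1)).le),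
        div_lt_iff₀ (rpos (j + 1))]
      have e : ((l - 1 : ℕ) : ℝ) = Λ := by
        rw [hΛ, Nat.cast_sub (Fact.out : l.Prime).one_le, Nat.cast_one]
      rw [e]
      exact h
    have h1 := (Fact.out : l.Prime).one_le
    omega
  -- the minimal `m` with `r_{N+2+m} ≤ x'/Λ`
  have hex : ∃ s : ℕ, Λ * r (N + 2 + s) ≤ x' := by
    refine ⟨2 * l, ?_⟩
    have h1 := erem_pow hx h0p h1p (N + 1) l
    have e : N + 1 + 1 + 2 * l = N + 2 + 2 * l := by ring
    rw [e] at h1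
    have h2 : r (N + 2) < x' := erem_lt hx h0p h1p N
    have h3 : Λ ≤ (2 : ℝ) ^ l := by
      have : (l : ℝ) < (2 : ℝ) ^ l := by exact_mod_cast Nat.lt_two_pow_self
      linarith
    have h4 : (0 : ℝ) < (2 : ℝ) ^ l := by positivity
    calc Λ * r (N + 2 + 2 * l) ≤ (2 : ℝ) ^ l * (erem (w 0) (w 1) (N + 1 + 1) / 2 ^ l) := by
          apply mul_le_mul h3 h1 (rpos _).le h4.le
      _ = r (N + 2) := by rw [hr]; field_simp
      _ ≤ x' := h2.le
  set m := Nat.find hex with hmdef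
  have hm : Λ * r (N + 2 + m) ≤ x' := Nat.find_spec hex
  have hmin : ∀ s, s < m → ¬ Λ * r (N + 2 + s) ≤ x' := fun s hs => Nat.find_min hex hs
  have hmle : m ≤ 2 * l := Nat.find_min' hex (by
    have h1 := erem_pow hx h0p h1p (N + 1) l
    have e : N + 1 + 1 + 2 * l = N + 2 + 2 * l := by ring
    rw [e] at h1
    have h2 : r (N + 2) < x' := erem_lt hx h0p h1p N
    have h3 : Λ ≤ (2 : ℝ) ^ l := by
      have : (l : ℝ) < (2 : ℝ) ^ l := by exact_mod_cast Nat.lt_two_pow_self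
      linarith
    have h4 : (0 : ℝ) < (2 : ℝ) ^ l := by positivity
    calc Λ * r (N + 2 + 2 * l) ≤ (2 : ℝ) ^ l * (erem (w 0) (w 1) (N + 1 + 1) / 2 ^ l) := by
          apply mul_le_mul h3 h1 (rpos _).le h4.le
      _ = r (N + 2) := by rw [hr]; field_simp
      _ ≤ x' := h2.le)
  -- `m ≥ 1` by the bounded tail at `N + 1`
  have hm1 : 1 ≤ m := by
    by_contra h
    push Not at h
    have hm0 : m = 0 := by omega
    have h1 := hm
    rw [hm0, add_zero] at h1
    have h2 := (htail (N + 1) (by omega)).2.2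
    have : x' < Λ * r (N + 2) := h2
    linarith
  obtain ⟨m', hm'⟩ : ∃ m', m = m' + 1 := ⟨m - 1, by omega⟩
  -- `δ = ρ / x'` with `ρ = r_{N+2+m}`; bounds `Λ ρ ≤ x'` and `x' < Λ² ρ`
  set ρ := r (N + 2 + m) with hρ
  have hρpos : 0 < ρ := rpos _
  have hρup : Λ * ρ ≤ x' := hm
  have hρlow : x' < Λ ^ 2 * ρ := by
    have h1 : ¬ Λ * r (N + 2 + m') ≤ x' := hmin m' (by omega)
    push Not at h1
    have h2 := (htail (N + 2 + m') (by omega)).2.2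
    have e : N + 2 + m' + 1 = N + 2 + m := by omega
    rw [e] at h2
    change r (N + 2 + m') < Λ * ρ at h2
    nlinarith
  set δ := ρ / x' with hδ
  have hδpos : 0 < δ := div_pos hρpos hx'pos
  have hδL : δ ≤ 1 / Λ := by
    rw [hδ, div_le_div_iff₀ hx'pos hΛpos]
    linarith
  have hL1 : 1 / Λ < 1 := by rw [div_lt_one hΛpos]; exact hΛgt
  have hδinv : 1 / δ < Λ ^ 2 := by
    rw [hδ, one_div_div, div_lt_iff₀ hρpos]
    exact hρlow
  -- the coefficient `A` of `ρ = A x + B x'`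
  set A := lA (w 0) (w 1) N (m + 2) with hAdef
  set B := lB (w 0) (w 1) N (m + 2) with hBdef
  have hlin : ρ = (A : ℝ) * x + (B : ℝ) * x' := by
    have := erem_eq_lin (w 0) (w 1) N (m + 2)
    have e : N + (m + 2) = N + 2 + m := by ring
    rw [e] at this
    exact this
  have hA0 : A ≠ 0 := lA_ne_zero hx h0p h1p N (m + 2) (by omega)
  have hAabs : |A| ≤ ((l : ℤ) - 1) ^ (m + 2) :=
    abs_lA_le (w 0) (w 1) N (K := (l : ℤ) - 1)
      (by have := (Fact.out : l.Prime).two_le; omega) hq (m + 2)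
  set k : ℕ := A.natAbs with hkdef
  have hk1 : 1 ≤ k := Int.natAbs_pos.mpr hA0
  have hkR : (k : ℝ) ≤ Λ ^ (2 * l + 2) := by
    have h1 : ((k : ℕ) : ℤ) = |A| := Int.natCast_natAbs A
    have h2 : |A| ≤ ((l : ℤ) - 1) ^ (2 * l + 2) := by
      refine le_trans hAabs (pow_le_pow_right₀ ?_ (by omega))
      have := (Fact.out : l.Prime).two_le
      omega
    have h3 : ((k : ℕ) : ℤ) ≤ ((l : ℤ) - 1) ^ (2 * l + 2) := h1 ▸ h2
    have h4 : ((k : ℕ) : ℝ) ≤ (((l : ℤ) - 1 : ℤ) : ℝ) ^ (2 * l + 2) := by exact_mod_cast h3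
    simpa [hΛ] using h4
  -- `k θ = p + s δ` with `s = ±1`, `p ∈ ℤ`, `θ = x / x'`
  obtain ⟨p, s, hs, hkθ⟩ : ∃ (p : ℤ) (s : ℝ), (s = 1 ∨ s = -1) ∧
      (k : ℝ) * (x / x') = (p : ℝ) + s * δ := by
    have hxq : (A : ℝ) * (x / x') = -(B : ℝ) + δ := by
      rw [hδ, hlin]
      field_simp
      ring
    rcases lt_or_gt_of_ne hA0 with hneg | hpos
    · refine ⟨B, -1, Or.inr rfl, ?_⟩
      have : (k : ℝ) = -(A : ℝ) := by
        have : ((k : ℕ) : ℤ) = -A := by rw [hkdef]; omega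
        exact_mod_cast this
      rw [this, neg_mul, hxq]
      ring
    · refine ⟨-B, 1, Or.inl rfl, ?_⟩
      have : (k : ℝ) = (A : ℝ) := by
        have : ((k : ℕ) : ℤ) = A := by rw [hkdef]; omega
        exact_mod_cast this
      rw [this, hxq]
      push_cast
      ring
  -- the stage-`N` state
  obtain ⟨V, C, hA, hr0, hr1, hrj, hc0, hc1, hcj⟩ := stage (t := t) hx hw N
  set X := w 2 with hXdef
  have hX : rw V w 2 = X := hrj 2 fin_zero_ne_two.symm fin_one_ne_two.symm
  have hXpos : 0 < X := hw 2
  -- covering: choose `j`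
  have hs' : (-s = 1 ∨ -s = -1) := by rcases hs with h | h <;> simp [h]
  obtain ⟨j, hj, hfr0, hfrL⟩ := exists_fract_mem (X / x') δ (1 / Λ) hδpos hδL hL1 (-s) hs'
  -- budget
  set i : ℕ := j * k with hidef
  have hjR : (j : ℝ) ≤ Λ ^ 2 + 1 := by linarith
  have hile : (i : ℝ) * x ≤ X := by
    have h1 : (i : ℝ) = (j : ℝ) * (k : ℝ) := by rw [hidef]; push_cast; ring
    have h2 : (i : ℝ) ≤ (Λ ^ 2 + 1) * Λ ^ (2 * l + 2) := by
      rw [h1]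
      apply mul_le_mul hjR hkR (Nat.cast_nonneg k) (by positivity)
    calc (i : ℝ) * x ≤ (Λ ^ 2 + 1) * Λ ^ (2 * l + 2) * x := mul_le_mul_of_nonneg_right h2 hxpos.le
      _ ≤ X := by rw [hxdef, hr]; exact hbud
  clear hbud
  -- move 1: `v₂ ← v₂ − i v₀`
  have hle1 : (i : ℝ) * rw V w 0 ≤ rw V w 2 := by rw [hr0, hX]; exact hile
  have hA1 := hA.transvect fin_zero_ne_two.symm i hle1
  set V₁ := transvection (2 : Fin (n + 3)) 0 (-(i : ℤ)) * V with hV₁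
  set C₁ := C * transvection (2 : Fin (n + 3)) 0 (i : ℤ) with hC₁
  have hV₁0 : rw V₁ w 0 = x := by
    rw [hV₁, rw_transvection_mul, if_neg fin_zero_ne_two, add_zero, hr0]
  have hV₁1 : rw V₁ w 1 = x' := by
    rw [hV₁, rw_transvection_mul, if_neg fin_one_ne_two, add_zero, hr1]
  have hV₁2 : rw V₁ w 2 = X - (i : ℝ) * x := by
    rw [hV₁, rw_transvection_mul, if_pos rfl, hr0, hX]
    push_cast
    ring
  have hV₁j : ∀ a, a ≠ 0 → a ≠ 1 → a ≠ 2 → rw V₁ w a = w a := by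
    intro a ha0 ha1 ha2
    rw [hV₁, rw_transvection_mul, if_neg ha2, add_zero, hrj a ha0 ha1]
  have hX1 : 0 ≤ X - (i : ℝ) * x := by linarith
  -- move 2: `v₂ ← v₂ − j' v₁`, `j' = ⌊(X − i x)/x'⌋`
  set j' : ℕ := ⌊(X - (i : ℝ) * x) / x'⌋₊ with hj'
  have hle2 : (j' : ℝ) * rw V₁ w 1 ≤ rw V₁ w 2 := by
    rw [hV₁1, hV₁2]
    have := Nat.floor_le (div_nonneg hX1 hx'pos.le)
    rw [← hj'] at this
    rwa [le_div_iff₀ hx'pos] at this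
  have hA2 := hA1.transvect fin_one_ne_two.symm j' hle2
  set V₂ := transvection (2 : Fin (n + 3)) 1 (-(j' : ℤ)) * V₁ with hV₂
  set y := rw V₂ w 2 with hydef
  have hy : y = Int.fract ((X - (i : ℝ) * x) / x') * x' := by
    rw [hydef, hV₂, rw_transvection_mul, if_pos rfl, hV₁1, hV₁2]
    push_cast
    rw [← sub_floor_mul_eq_fract_mul hX1 hx'pos, hj']
    ring
  have hfr : Int.fract ((X - (i : ℝ) * x) / x') = Int.fract (X / x' + -s * ((j : ℝ) * δ)) := by
    have e : (X - (i : ℝ) * x) / x' = (X / x' + -s * ((j : ℝ) * δ)) - (((j : ℤ) * p : ℤ) : ℝ) := by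
      have h1 : (i : ℝ) = (j : ℝ) * (k : ℝ) := by rw [hidef]; push_cast; ring
      have h2 : (X - (i : ℝ) * x) / x' = X / x' - (j : ℝ) * ((k : ℝ) * (x / x')) := by
        rw [h1]
        field_simp
      rw [h2, hkθ]
      push_cast
      ring
    rw [e, Int.fract_sub_intCast]
  have hypos : 0 < y := by rw [hy, hfr]; exact mul_pos hfr0 hx'pos
  have hyup : Λ * y ≤ x' := by
    rw [hy, hfr]
    have h1 : Int.fract (X / x' + -s * ((j : ℝ) * δ)) ≤ 1 / Λ := hfrL
    calc Λ * (Int.fract (X / x' + -s * ((j : ℝ) * δ)) * x')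
        ≤ Λ * (1 / Λ * x') := by
          apply mul_le_mul_of_nonneg_left _ hΛpos.le
          exact mul_le_mul_of_nonneg_right h1 hx'pos.le
      _ = x' := by field_simp
  have hV₂0 : rw V₂ w 0 = x := by
    rw [hV₂, rw_transvection_mul, if_neg fin_zero_ne_two, add_zero, hV₁0]
  have hV₂1 : rw V₂ w 1 = x' := by
    rw [hV₂, rw_transvection_mul, if_neg fin_one_ne_two, add_zero, hV₁1]
  have hV₂j : ∀ a, a ≠ 0 → a ≠ 1 → a ≠ 2 → rw V₂ w a = w a := by
    intro a ha0 ha1 ha2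
    rw [hV₂, rw_transvection_mul, if_neg ha2, add_zero, hV₁j a ha0 ha1 ha2]
  have hc₂1 : rt V₂ t 1 = echar (w 0) (w 1) (t 0) (t 1) (N + 1) := by
    rw [hV₂, rt_transvection_mul, if_neg fin_one_ne_two, add_zero, hV₁, rt_transvection_mul,
      if_neg fin_one_ne_two, add_zero, hc1]
  have hu' : echar (w 0) (w 1) (t 0) (t 1) (N + 1) ≠ 0 := (htail N le_rfl).2.1
  -- lateness consequences: `Λ y ≤ x' < x ≤ w a`
  have hxw : ∀ a, x ≤ w a := fun a => by
    have := hlate a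
    nlinarith
  -- finish
  by_cases hc' : rt V₂ t 2 = 0
  · -- neutral small coin `y` next to the charged row `1`
    refine hA2.abc_of_neutral (t := t) (z := 2) (c := 1) fin_one_ne_two hc'
      (by rw [← hydef]; exact hypos) (by rw [hc₂1]; exact hu') ?_
    intro a ha1 ha2
    right
    rw [← hydef]
    by_cases ha0 : a = 0
    · rw [ha0, hV₂0]; linarith
    · rw [hV₂j a ha0 ha1 ha2]; linarith [hxw a]
  · -- row `2` is dominant
    refine hA2.abc_of_dominant (t := t) 2 hc' ?_
    intro a ha2
    right
    rw [← hydef, ← hΛ]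
    by_cases ha0 : a = 0
    · rw [ha0, hV₂0]; linarith
    · by_cases ha1 : a = 1
      · rw [ha1, hV₂1]; exact hyup
      · rw [hV₂j a ha0 ha1 ha2]; linarith [hxw a]

/-- **The lattice step in `n + 3` variables when `w₀/w₁` is irrational.** [folklore] -/
theorem main012 [Fact l.Prime] {t : Fin (n + 3) → ZMod l} {w : Fin (n + 3) → ℝ} (ht : t ≠ 0)
    (hw : ∀ j, 0 < w j) (hx : Irrational (w 0 / w 1)) : LatticeABC (n + 3) l t w := by
  classical
  have h0p := hw 0
  have h1p := hw 1
  set Λ : ℝ := (l : ℝ) - 1 with hΛ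
  have hΛ1 : 1 ≤ Λ := one_le_cast_prime_sub_one
  -- lateness threshold (`B` = the budget constant `((l−1)²+1)(l−1)^{2l+2}` of `reservoir`)
  set B : ℝ := (Λ ^ 2 + 1) * Λ ^ (2 * l + 2) with hB
  have hBnn : 0 ≤ B := by rw [hB]; positivity
  obtain ⟨j₀, hj₀⟩ := Finite.exists_min w
  have hcpos : 0 < Λ + B := by linarith
  obtain ⟨N₀, hN₀⟩ := erem_small hx h0p h1p (div_pos (hw j₀) hcpos)
  set N := max N₀ 1 with hNdef
  have hN1 : 1 ≤ N := le_max_right _ _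
  have hlateN : ∀ m, N ≤ m → (∀ j, Λ * erem (w 0) (w 1) m ≤ w j) ∧
      B * erem (w 0) (w 1) m ≤ w 2 := by
    intro m hm
    have h1 := hN₀ m (le_trans (le_max_left _ _) hm)
    rw [lt_div_iff₀ hcpos] at h1
    have hr := (erem_pos hx h0p h1p m).le
    refine ⟨fun j => ?_, ?_⟩
    · nlinarith [hj₀ j]
    · nlinarith [hj₀ 2]
  by_cases hD : ∀ m, N ≤ m → echar (w 0) (w 1) (t 0) (t 1) m ≠ 0 ∧
      echar (w 0) (w 1) (t 0) (t 1) (m + 1) ≠ 0 ∧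
      erem (w 0) (w 1) m < ((l : ℝ) - 1) * erem (w 0) (w 1) (m + 1)
  · exact reservoir hw hx N hN1 hD (hlateN N le_rfl).1 (hlateN N le_rfl).2
  · push Not at hD
    obtain ⟨m, hm, himp⟩ := hD
    obtain ⟨V, C, hA, hr0, hr1, hrj, hc0, hc1, hcj⟩ := stage (t := t) hx hw m
    have hlate := (hlateN m hm).1
    have hdec : erem (w 0) (w 1) (m + 1) < erem (w 0) (w 1) m := by
      obtain ⟨m', rfl⟩ : ∃ m', m = m' + 1 := ⟨m - 1, by omega⟩
      exact erem_lt hx h0p h1p m'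
    have hr1pos : 0 < erem (w 0) (w 1) (m + 1) := erem_pos hx h0p h1p _
    -- coins of rows `j ∉ {0,1}` dominate `Λ ·` both running coins
    have hbig : ∀ j, j ≠ 0 → j ≠ 1 → Λ * erem (w 0) (w 1) m ≤ rw V w j := by
      intro j hj0 hj1
      rw [hrj j hj0 hj1]
      exact hlate j
    have hbig' : ∀ j, j ≠ 0 → j ≠ 1 → Λ * erem (w 0) (w 1) (m + 1) ≤ rw V w j := by
      intro j hj0 hj1
      have := hbig j hj0 hj1
      nlinarith
    by_cases hu : echar (w 0) (w 1) (t 0) (t 1) m = 0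
    · by_cases hu' : echar (w 0) (w 1) (t 0) (t 1) (m + 1) = 0
      · -- both running charges vanish: some other row is charged; row `1` is a neutral coin
        obtain ⟨k, hk⟩ := hA.exists_rt_ne_zero ht
        have hk0 : k ≠ 0 := by rintro rfl; exact hk (by rw [hc0, hu])
        have hk1 : k ≠ 1 := by rintro rfl; exact hk (by rw [hc1, hu'])
        refine hA.abc_of_neutral (t := t) (z := 1) (c := k) hk1 (by rw [hc1, hu'])
          (by rw [hr1]; exact hr1pos) hk ?_
        intro a hak ha1
        by_cases ha0 : a = 0
        · exact Or.inl (by rw [ha0, hc0, hu])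
        · right; rw [hr1, ← hΛ]; exact hbig' a ha0 ha1
      · -- `u_m = 0 ≠ u_{m+1}`: row `1` is dominant
        refine hA.abc_of_dominant (t := t) 1 (by rw [hc1]; exact hu') ?_
        intro a ha1
        by_cases ha0 : a = 0
        · exact Or.inl (by rw [ha0, hc0, hu])
        · right; rw [hr1, ← hΛ]; exact hbig' a ha0 ha1
    · by_cases hu' : echar (w 0) (w 1) (t 0) (t 1) (m + 1) = 0
      · -- `u_m ≠ 0 = u_{m+1}`: row `0` is dominant
        refine hA.abc_of_dominant (t := t) 0 (by rw [hc0]; exact hu) ?_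
        intro a ha0
        by_cases ha1 : a = 1
        · exact Or.inl (by rw [ha1, hc1, hu'])
        · right; rw [hr0, ← hΛ]; exact hbig a ha0 ha1
      · -- both nonzero and a large quotient: row `1` is dominant
        have hge := himp hu hu'
        refine hA.abc_of_dominant (t := t) 1 (by rw [hc1]; exact hu') ?_
        intro a ha1
        right
        rw [hr1, ← hΛ]
        by_cases ha0 : a = 0
        · rw [ha0, hr0]; exact hge
        · exact hbig' a ha0 ha1

end Main

end Lattice94

open Lattice94 in
/-- **The lattice step of Cossart–Piltant 2008, Lemma 9.4 (HAL p. 30, l. 23–31), for every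
`d ≥ 3`**: for `l` prime, `t : Fin d → ℤ/l` nonzero and all weights `wⱼ > 0` there is a basis
`(v₁,…,v_d)` of `ℤ^d` with (a) `(l v_{i₀}, (vᵢ)_{i ≠ i₀})` a basis of `N = {v | v·t ≡ 0}`,
(b) `ℕ^d ⊆ Σ ℕ vᵢ`, (c) `vᵢ · w ≥ 0`. (FALSE for `d = 2`: `not_latticeABC_two_five`.)
[cite: CossartPiltant2008, Lemma 9.4, proof (HAL p. 30, l. 23–31)] -/
theorem latticeABC_of_three_le {d l : ℕ} [Fact l.Prime] (hd : 3 ≤ d) (t : Fin d → ZMod l)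
    (w : Fin d → ℝ) (ht : t ≠ 0) (hw : ∀ j, 0 < w j) : LatticeABC d l t w := by
  obtain ⟨n, rfl⟩ : ∃ n, d = n + 3 := ⟨d - 3, by omega⟩
  by_cases hI : ∃ i j : Fin (n + 3), Irrational (w i / w j)
  · obtain ⟨i, j, hij⟩ := hI
    have hne : i ≠ j := by
      rintro rfl
      rw [div_self (hw i).ne'] at hij
      exact hij.ne_one rfl
    have hj0 : Equiv.swap (0 : Fin (n + 3)) i j ≠ 0 := by
      intro h
      have := congr_arg (Equiv.swap (0 : Fin (n + 3)) i) h
      rw [Equiv.swap_apply_self, Equiv.swap_apply_left] at this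
      exact hne this.symm
    set σ : Equiv.Perm (Fin (n + 3)) :=
      Equiv.swap 0 i * Equiv.swap 1 (Equiv.swap 0 i j) with hσ
    have hσ0 : σ 0 = i := by
      rw [hσ, Equiv.Perm.mul_apply,
        Equiv.swap_apply_of_ne_of_ne fin_zero_ne_one hj0.symm, Equiv.swap_apply_left]
    have hσ1 : σ 1 = j := by
      rw [hσ, Equiv.Perm.mul_apply, Equiv.swap_apply_left, Equiv.swap_apply_self]
    refine latticeABC_comp_perm σ (main012 ?_ (fun a => hw (σ a)) ?_)
    · intro h0
      apply ht
      funext a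
      have := congr_fun h0 (σ.symm a)
      simpa using this
    · change Irrational (w (σ 0) / w (σ 1))
      rw [hσ0, hσ1]
      exact hij
  · push Not at hI
    obtain ⟨g, hg, m, hm⟩ := exists_commensurable_of_forall_not_irrational w hw hI
    exact latticeABC_of_commensurable t w ht g hg m hm

end Literature.AlgebraicGeometry.CossartPiltant200819.CP2008

end
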